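import Summits.Ventures.PercRepro.RankLevelSetBiIndepTruncate
import Summits.Ventures.PercRepro.RankLevelSetBiIndepLR

/-! # RankLevelSetBiIndepLRTruncate — TRUNCATION PRESERVES THE LIKELIHOOD-RATIO MONOTONICITY (LR) (night-1 g26;
dossier §38.10)

THEOREM (`biIndepLR_truncateTo`): `BiIndepLR M → BiIndepLR (truncateTo M k)`. PROOF: the bi-independent family of
the truncation `T_k M` is the window `n − k ≤ r ≤ k` of that of `M` (`biIndep_truncateTo`), so the marked counts of
`T_k M` are those of `M` inside the window and `0` outside; a TP2 inequality `a_q b_p ≤ a_p b_q` (`p ≤ q`) of `T_k M`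
is trivial when its left side vanishes, and otherwise `p` and `q + 1` lie in the window, hence so do `p + 1` and `q`,
and the inequality is the one of `M`. Nothing here asserts (LR); every declaration has a docstring; imports: the
cell's own modules and Mathlib only. Axioms: standard. -/

namespace PercRepro

open Set Matroid

variable {α : Type}

/-- **The through-`y` count of the truncation**: `a_j(T_k M; y) = a_j(M; y)` inside the window, `0` outside. -/
lemma yThroughCount_truncateTo (M : Matroid α) [M.Finite] (k : ℕ) (y : α) (j : ℕ) :
    haveI := truncateTo_finite M k
    yThroughCount (truncateTo M k) y j =
      if j + 1 ≤ k ∧ M.E.ncard - (j + 1) ≤ k then yThroughCount M y j else 0 := by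
  haveI := truncateTo_finite M k
  unfold yThroughCount
  rw [biIndep_truncateTo]
  split_ifs with hw
  · rfl
  · simp

/-- **The avoid-`y` count of the truncation**: `b_j(T_k M; y) = b_j(M; y)` inside the window, `0` outside. -/
lemma yAvoidCount_truncateTo (M : Matroid α) [M.Finite] (k : ℕ) (y : α) (j : ℕ) :
    haveI := truncateTo_finite M k
    yAvoidCount (truncateTo M k) y j =
      if j ≤ k ∧ M.E.ncard - j ≤ k then yAvoidCount M y j else 0 := by
  haveI := truncateTo_finite M k
  unfold yAvoidCount
  rw [biIndep_truncateTo]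
  split_ifs with hw
  · rfl
  · simp

/-- **Truncation preserves (LR)**: `BiIndepLR M → BiIndepLR (truncateTo M k)`. -/
theorem biIndepLR_truncateTo (M : Matroid α) [M.Finite] (k : ℕ) (hM : BiIndepLR M) :
    haveI := truncateTo_finite M k
    BiIndepLR (truncateTo M k) := by
  haveI := truncateTo_finite M k
  intro y hy p q hpq
  rw [truncateTo_E] at hy
  rw [yThroughCount_truncateTo, yThroughCount_truncateTo, yAvoidCount_truncateTo, yAvoidCount_truncateTo]
  by_cases hq : q + 1 ≤ k ∧ M.E.ncard - (q + 1) ≤ k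
  · by_cases hp : p ≤ k ∧ M.E.ncard - p ≤ k
    · rw [if_pos hq, if_pos hp, if_pos (by omega), if_pos (by omega)]
      exact hM y hy p q hpq
    · rw [if_neg hp, mul_zero]
      exact Nat.zero_le _
  · rw [if_neg hq, zero_mul]
    exact Nat.zero_le _

end PercRepro
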